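import Literature.Geometry.Lorentzian.WeightedNorms
import Literature.Geometry.Lorentzian.ChartCalculus
import HarnessLib

/-!
# Triangle inequality for the weighted `Cᵏ_δ` seminorm and the weighted `Cᵏ` data distance:
discharge of `weightedCkSeminorm_add_le`, `InitialDataSet.contDiffOn_hFun`,
`InitialDataSet.contDiffOn_kFun` and `InitialDataSet.dataWeightedCkEDist_triangle`

Companion ("Proofs") file of `Literature/Geometry/Lorentzian/WeightedNorms.lean`. That file
defines the weighted sup seminorms
`weightedCkSeminorm U k δ f = sup_{m ≤ k} sup_{x ∈ U} (1 + ‖x‖)^{δ+m} ‖D^m f(x)‖` (Bartnik,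
CPAM 39 (1986), §1, Def. 1.1 and (1.2) with `p = ∞`, in the Choquet-Bruhat–Christodoulou
orientation of `δ`; see the module docstring there) and the `C^k_δ × C^{k-1}_{δ+1}` distance
`InitialDataSet.dataWeightedCkEDist k δ D₁ D₂` of two initial data sets on an open `U ⊆ E3`, and
vendors as named facts

* `weightedCkSeminorm_add_le`: `‖f + g‖_{C^k_δ(U)} ≤ ‖f‖_{C^k_δ(U)} + ‖g‖_{C^k_δ(U)}` for `U` open
  and `f`, `g` smooth on `U`;
* `InitialDataSet.contDiffOn_hFun`, `InitialDataSet.contDiffOn_kFun`: the components `hFun D`,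
  `kFun D` of data on an open `U ⊆ E3` are smooth on `U`;
* `InitialDataSet.dataWeightedCkEDist_triangle`: the triangle inequality of the data distance.

This file PROVES all four (`…_holds`).

## Proof

* `weightedCkSeminorm_add_le_holds`. Mathlib's `iteratedFDeriv ℝ m` takes junk values where a
  function is not differentiable, so `D^m (f + g) = D^m f + D^m g` (`iteratedFDeriv_add_apply`)
  needs `f`, `g` of class `C^m` *at the point*; on an open `U` this follows from `ContDiffOn`
  (`ContDiffOn.contDiffAt`). The rest is `‖A + B‖ ≤ ‖A‖ + ‖B‖`, monotonicity and additivity of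
  `ENNReal.ofReal` on nonnegative reals, and `sup ≤` of pointwise bounds
  (`ofReal_mul_norm_iteratedFDeriv_le_weightedCkSeminorm`).
* `contDiffOn_hFun_holds`, `contDiffOn_kFun_holds`. The bundle of bilinear forms on `TU`, in
  which `h` and `k` are `C^∞` sections (`ContMDiffRiemannianMetric.contMDiff`,
  `InitialDataSet.contMDiff_k`), is trivialised over the single chart `U ↪ E3` by the identity,
  so a section is `C^∞` iff its representative `E3 → (E3 →L E3 →L ℝ)` is
  (`OpensChart.contMDiffAt_bilinSection_iff`, file `ChartCalculus`); `hFun D`, `kFun D` are such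
  representatives (`hFun_of_mem`, `kFun_of_mem`).
* `dataWeightedCkEDist_triangle_holds`: `h₁ - h₃ = (h₁ - h₂) + (h₂ - h₃)`, likewise for `k`, and
  two applications of the seminorm triangle inequality (the differences are smooth on `U`).

In print (Bartnik 1986, §1) the `W^{k,p}_δ`, `1 ≤ p ≤ ∞`, are normed spaces by definition
((1.1)–(1.2) are sums of weighted `L^p` norms of classical/weak derivatives); the only content
here is the bookkeeping of Mathlib's junk-valued `iteratedFDeriv` against genuine smoothness.

## Minkowski's inequality for the weighted Sobolev seminorm (`weightedSobolevSeminorm_add_le`) and the weighted Sobolev data distance (`dataWeightedSobolevEDist_triangle`)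

This file also discharges the named facts `weightedSobolevSeminorm_add_le` and
`InitialDataSet.dataWeightedSobolevEDist_triangle` of `WeightedNorms`
(`weightedSobolevSeminorm_add_le_holds`, `InitialDataSet.dataWeightedSobolevEDist_triangle_holds`):
for `U` open in a real normed space `F` carrying a Borel measure, and `f g` smooth on `U`,
`‖f + g‖_{H^s_δ(U)} ≤ ‖f‖_{H^s_δ(U)} + ‖g‖_{H^s_δ(U)}` for
`weightedSobolevSeminorm U s δ f = (∑_{m ≤ s} ∫_U (1+‖x‖)^{2(δ+m)} ‖D^m f(x)‖² dx)^{1/2}` — i.e.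
Bartnik's weighted Sobolev norms `‖u‖_{k,p,δ} = ∑_{j ≤ k} ‖D^j u‖_{p,δ-j}` (Def. 1.1 and
(1.1)–(1.2), CPAM 39 (1986), p. 663; the `W^{k,p}_δ` are Banach spaces) satisfy the triangle
inequality, which in print is Minkowski's inequality order by order. Our realisation combines the
orders `m ≤ s` in `ℓ²` rather than `ℓ¹` (the `H_{s,δ}` convention of Choquet-Bruhat–Christodoulou,
Acta Math. 146 (1981), §2), so the argument becomes: Minkowski in `L²(U)` for each order `m`
(Mathlib `ENNReal.lintegral_Lp_add_le`, `p = 2`), then Minkowski in `ℓ²` over `m ≤ s` (Mathlib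
`ENNReal.Lp_add_le`, `p = 2`) — the abstract step `rpow_sum_lintegral_rpow_le_add`. Its inputs:
for `x ∈ U`, `D^m (f+g)(x) = D^m f(x) + D^m g(x)` (`iteratedFDeriv_add_apply` at the interior
point `x`), so the order-`m` size functions `φ_m(u)(x) = (1+‖x‖)^{δ+m} ‖D^m u(x)‖`, whose squares
are the integrands (`weightedSobolevSeminorm_eq_rpow_sum_lintegral`), satisfy
`φ_m(f+g) ≤ φ_m(f) + φ_m(g)` on `U` (`ofReal_weight_mul_norm_iteratedFDeriv_add_le`); and
`φ_m(f)`, `φ_m(g)` are continuous on `U` (`ContDiffOn.continuousOn_iteratedFDerivWithin`,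
`iteratedFDerivWithin_of_isOpen`), hence a.e.-measurable for `volume.restrict U`
(`ContinuousOn.aemeasurable` — this is where `BorelSpace F` and `IsOpen U` enter;
`aemeasurable_ofReal_weight_mul_norm_iteratedFDeriv`). Without measurability Minkowski's
inequality for lower Lebesgue integrals can fail, so these hypotheses of the fact are used. The
data-distance triangle inequality then follows exactly as for the `Cᵏ` distance:
`h₁ - h₃ = (h₁ - h₂) + (h₂ - h₃)`, likewise for `k`, the differences being smooth on `U`.

## References

* R. Bartnik, *The mass of an asymptotically flat manifold*, Comm. Pure Appl. Math. 39 (1986),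
  661–693, §1, Def. 1.1, (1.1)–(1.2) (p. 663). [Bartnik1986]
* D. Christodoulou, S. Klainerman, *The global nonlinear stability of the Minkowski space*
  (1993), §1, (1.0.9).
-/

open Manifold Bundle TopologicalSpace
open scoped ContDiff Topology ENNReal NNReal

noncomputable section

namespace Literature.Geometry.Lorentzian

/-! ### The weighted `Cᵏ_δ` seminorm is subadditive on functions smooth on an open set -/

section Seminorms

variable {F G : Type*} [NormedAddCommGroup F] [NormedSpace ℝ F] [NormedAddCommGroup G]
  [NormedSpace ℝ G]

/-- Pointwise form of the triangle inequality: for `U` open, `f`, `g` smooth on `U`, `m ≤ k` and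
`x ∈ U`, `(1+‖x‖)^{δ+m} ‖D^m (f + g)(x)‖ ≤ ‖f‖_{C^k_δ(U)} + ‖g‖_{C^k_δ(U)}` (here
`D^m (f + g)(x) = D^m f(x) + D^m g(x)` because `f`, `g` are `C^m` at the interior point `x`).
Bartnik 1986, §1, Def. 1.1 and (1.2) with `p = ∞`. [cite: Bartnik1986, §1, Def. 1.1 and (1.2)] -/
theorem ofReal_mul_norm_iteratedFDeriv_add_le_weightedCkSeminorm_add {U : Set F} (hU : IsOpen U)
    {k m : ℕ} (hm : m ≤ k) (δ : ℝ) {f g : F → G} (hf : ContDiffOn ℝ ∞ f U)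
    (hg : ContDiffOn ℝ ∞ g U) {x : F} (hx : x ∈ U) :
    ENNReal.ofReal ((1 + ‖x‖) ^ (δ + m : ℝ) * ‖iteratedFDeriv ℝ m (f + g) x‖) ≤
      weightedCkSeminorm U k δ f + weightedCkSeminorm U k δ g := by
  have hfx : ContDiffAt ℝ m f x :=
    (hf.contDiffAt (hU.mem_nhds hx)).of_le (by exact_mod_cast le_top)
  have hgx : ContDiffAt ℝ m g x :=
    (hg.contDiffAt (hU.mem_nhds hx)).of_le (by exact_mod_cast le_top)
  have hw : 0 ≤ (1 + ‖x‖) ^ (δ + m : ℝ) := Real.rpow_nonneg (by positivity) _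
  rw [iteratedFDeriv_add_apply hfx hgx]
  calc ENNReal.ofReal ((1 + ‖x‖) ^ (δ + m : ℝ) *
          ‖iteratedFDeriv ℝ m f x + iteratedFDeriv ℝ m g x‖)
      ≤ ENNReal.ofReal ((1 + ‖x‖) ^ (δ + m : ℝ) * ‖iteratedFDeriv ℝ m f x‖ +
          (1 + ‖x‖) ^ (δ + m : ℝ) * ‖iteratedFDeriv ℝ m g x‖) := by
        refine ENNReal.ofReal_le_ofReal ?_
        rw [← mul_add]
        exact mul_le_mul_of_nonneg_left (norm_add_le _ _) hw
    _ = ENNReal.ofReal ((1 + ‖x‖) ^ (δ + m : ℝ) * ‖iteratedFDeriv ℝ m f x‖) +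
          ENNReal.ofReal ((1 + ‖x‖) ^ (δ + m : ℝ) * ‖iteratedFDeriv ℝ m g x‖) :=
        ENNReal.ofReal_add (mul_nonneg hw (norm_nonneg _)) (mul_nonneg hw (norm_nonneg _))
    _ ≤ weightedCkSeminorm U k δ f + weightedCkSeminorm U k δ g :=
        add_le_add (ofReal_mul_norm_iteratedFDeriv_le_weightedCkSeminorm hm δ f hx)
          (ofReal_mul_norm_iteratedFDeriv_le_weightedCkSeminorm hm δ g hx)

/-- **Triangle inequality for the weighted `Cᵏ_δ` seminorm** on an open set `U`, for functions
smooth on `U`: `‖f + g‖_{C^k_δ(U)} ≤ ‖f‖_{C^k_δ(U)} + ‖g‖_{C^k_δ(U)}` (the statement of the named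
fact `weightedCkSeminorm_add_le`, with explicit arguments). Bartnik 1986, §1, Def. 1.1 and (1.2)
with `p = ∞` (the `W^{k,∞}_δ` norm). [cite: Bartnik1986, §1, Def. 1.1 and (1.2)] -/
theorem weightedCkSeminorm_add_le_of_contDiffOn {U : Set F} (hU : IsOpen U) (k : ℕ) (δ : ℝ)
    {f g : F → G} (hf : ContDiffOn ℝ ∞ f U) (hg : ContDiffOn ℝ ∞ g U) :
    weightedCkSeminorm U k δ (f + g) ≤ weightedCkSeminorm U k δ f + weightedCkSeminorm U k δ g := by
  show (⨆ (m : ℕ) (_ : m ≤ k), ⨆ x ∈ U,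
      ENNReal.ofReal ((1 + ‖x‖) ^ (δ + m : ℝ) * ‖iteratedFDeriv ℝ m (f + g) x‖)) ≤ _
  exact iSup₂_le fun m hm ↦ iSup₂_le fun x hx ↦
    ofReal_mul_norm_iteratedFDeriv_add_le_weightedCkSeminorm_add hU hm δ hf hg hx

/-- **Discharge of the named fact `weightedCkSeminorm_add_le`** (triangle inequality for the
weighted `Cᵏ_δ` seminorm of functions smooth on an open set). Bartnik 1986, §1, Def. 1.1 and
(1.2) with `p = ∞`. [cite: Bartnik1986, §1, Def. 1.1 and (1.2)] -/
theorem weightedCkSeminorm_add_le_holds : weightedCkSeminorm_add_le (F := F) (G := G) :=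
  fun hU k δ _ _ hf hg ↦ weightedCkSeminorm_add_le_of_contDiffOn hU k δ hf hg

end Seminorms

/-! ### Smoothness of the components of initial data on an open `U ⊆ E3` -/

namespace InitialDataSet

variable {U : Opens E3}

/-- The metric components `hFun D : E3 → (E3 →L E3 →L ℝ)` of data on an open `U ⊆ E3` are `C^∞`
at every point of `U`: `h` is a `C^∞` section of the bundle of bilinear forms on `TU`, which the
single chart `U ↪ E3` trivialises by the identity (`OpensChart.contMDiffAt_bilinSection_iff`).
O'Neill 1983, Ch. 3, p. 57 (open submanifolds); Bartnik 1986, §1. [folklore] -/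
theorem contDiffAt_hFun (D : InitialDataSet 𝓘(ℝ, E3) U) (x : U) : ContDiffAt ℝ ∞ D.hFun x :=
  (OpensChart.contMDiffAt_bilinSection_iff x D.h.inner D.hFun
    (fun y ↦ (D.hFun_of_mem y.2).symm)).1 (D.h.contMDiff x)

/-- The components `kFun D : E3 → (E3 →L E3 →L ℝ)` of the second fundamental form of data on an
open `U ⊆ E3` are `C^∞` at every point of `U` (same argument with `InitialDataSet.contMDiff_k`).
[folklore] -/
theorem contDiffAt_kFun (D : InitialDataSet 𝓘(ℝ, E3) U) (x : U) : ContDiffAt ℝ ∞ D.kFun x :=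
  (OpensChart.contMDiffAt_bilinSection_iff x D.k D.kFun
    (fun y ↦ (D.kFun_of_mem y.2).symm)).1 (D.contMDiff_k x)

/-- **Discharge of the named fact `contDiffOn_hFun`**: the metric components of data on an open
`U ⊆ E3` are smooth on `U`. Bartnik 1986, §1 (smooth metrics in the asymptotic chart).
[cite: Bartnik1986, §1] -/
theorem contDiffOn_hFun_holds : contDiffOn_hFun (U := U) :=
  fun D y hy ↦ (D.contDiffAt_hFun ⟨y, hy⟩).contDiffWithinAt

/-- **Discharge of the named fact `contDiffOn_kFun`**: the components of `k` of data on an open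
`U ⊆ E3` are smooth on `U`. Christodoulou–Klainerman 1993, §1.
[cite: ChristodoulouKlainerman1993, §1] -/
theorem contDiffOn_kFun_holds : contDiffOn_kFun (U := U) :=
  fun D y hy ↦ (D.contDiffAt_kFun ⟨y, hy⟩).contDiffWithinAt

/-! ### Triangle inequality for the weighted `Cᵏ` data distance -/

/-- **Discharge of the named fact `dataWeightedCkEDist_triangle`**: the weighted `Cᵏ` distance
`‖h₁ - h₂‖_{C^k_δ(U)} + ‖k₁ - k₂‖_{C^{k-1}_{δ+1}(U)}` of initial data sets on an open `U ⊆ E3`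
satisfies the triangle inequality (write `h₁ - h₃ = (h₁ - h₂) + (h₂ - h₃)`, likewise for `k`; the
differences are smooth on `U`, so `weightedCkSeminorm_add_le` applies). Bartnik 1986, §1,
Def. 1.1 and (1.2) with `p = ∞`, Def. 2.1. [cite: Bartnik1986, §1, Def. 1.1 and (1.2)] -/
theorem dataWeightedCkEDist_triangle_holds : dataWeightedCkEDist_triangle (U := U) := by
  intro k δ D₁ D₂ D₃
  have hU : IsOpen (U : Set E3) := U.isOpen
  have eh : D₁.hFun - D₃.hFun = (D₁.hFun - D₂.hFun) + (D₂.hFun - D₃.hFun) :=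
    (sub_add_sub_cancel D₁.hFun D₂.hFun D₃.hFun).symm
  have ek : D₁.kFun - D₃.kFun = (D₁.kFun - D₂.kFun) + (D₂.kFun - D₃.kFun) :=
    (sub_add_sub_cancel D₁.kFun D₂.kFun D₃.kFun).symm
  have h₁₂ : ContDiffOn ℝ ∞ (D₁.hFun - D₂.hFun) U :=
    (contDiffOn_hFun_holds D₁).sub (contDiffOn_hFun_holds D₂)
  have h₂₃ : ContDiffOn ℝ ∞ (D₂.hFun - D₃.hFun) U :=
    (contDiffOn_hFun_holds D₂).sub (contDiffOn_hFun_holds D₃)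
  have k₁₂ : ContDiffOn ℝ ∞ (D₁.kFun - D₂.kFun) U :=
    (contDiffOn_kFun_holds D₁).sub (contDiffOn_kFun_holds D₂)
  have k₂₃ : ContDiffOn ℝ ∞ (D₂.kFun - D₃.kFun) U :=
    (contDiffOn_kFun_holds D₂).sub (contDiffOn_kFun_holds D₃)
  unfold dataWeightedCkEDist
  rw [eh, ek]
  calc weightedCkSeminorm (U : Set E3) k δ ((D₁.hFun - D₂.hFun) + (D₂.hFun - D₃.hFun)) +
        weightedCkSeminorm (U : Set E3) (k - 1) (δ + 1)
          ((D₁.kFun - D₂.kFun) + (D₂.kFun - D₃.kFun))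
      ≤ (weightedCkSeminorm (U : Set E3) k δ (D₁.hFun - D₂.hFun) +
          weightedCkSeminorm (U : Set E3) k δ (D₂.hFun - D₃.hFun)) +
        (weightedCkSeminorm (U : Set E3) (k - 1) (δ + 1) (D₁.kFun - D₂.kFun) +
          weightedCkSeminorm (U : Set E3) (k - 1) (δ + 1) (D₂.kFun - D₃.kFun)) :=
        add_le_add (weightedCkSeminorm_add_le_of_contDiffOn hU k δ h₁₂ h₂₃)
          (weightedCkSeminorm_add_le_of_contDiffOn hU (k - 1) (δ + 1) k₁₂ k₂₃)
    _ = _ := add_add_add_comm _ _ _ _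

end InitialDataSet

/-! ### Minkowski's inequality for the weighted Sobolev seminorm `H^s_δ` -/

section SobolevMinkowski

open _root_.MeasureTheory
open scoped ENNReal

/-- **Minkowski's inequality in `L²(S × μ)`** for a finite index set `S` and a measure `μ`,
written with lower Lebesgue integrals: if `χ_m ≤ φ_m + ψ_m` `μ`-a.e. for every `m ∈ S`, with
`φ_m`, `ψ_m` a.e.-measurable, then
`(∑_{m ∈ S} ∫ χ_m²)^{1/2} ≤ (∑_{m ∈ S} ∫ φ_m²)^{1/2} + (∑_{m ∈ S} ∫ ψ_m²)^{1/2}` — Minkowski in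
`L²(μ)` for each `m` (`ENNReal.lintegral_Lp_add_le`) followed by Minkowski in `ℓ²(S)`
(`ENNReal.Lp_add_le`). This is the triangle inequality behind Bartnik's weighted Sobolev norms,
CPAM 39 (1986), §1, (1.1)–(1.2). [cite: Bartnik1986, §1, Def. 1.1 and (1.1)–(1.2), p. 663] -/
private theorem rpow_sum_lintegral_rpow_le_add {α : Type*} [MeasurableSpace α] (μ : Measure α)
    (S : Finset ℕ) {φ ψ χ : ℕ → α → ℝ≥0∞} (hφ : ∀ m ∈ S, AEMeasurable (φ m) μ)
    (hψ : ∀ m ∈ S, AEMeasurable (ψ m) μ) (hle : ∀ m ∈ S, ∀ᵐ x ∂μ, χ m x ≤ φ m x + ψ m x) :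
    (∑ m ∈ S, ∫⁻ x, χ m x ^ (2 : ℝ) ∂μ) ^ (1 / 2 : ℝ) ≤
      (∑ m ∈ S, ∫⁻ x, φ m x ^ (2 : ℝ) ∂μ) ^ (1 / 2 : ℝ) +
        (∑ m ∈ S, ∫⁻ x, ψ m x ^ (2 : ℝ) ∂μ) ^ (1 / 2 : ℝ) := by
  -- the order-`m` `L²(μ)` seminorms of `φ` and `ψ`
  set A : ℕ → ℝ≥0∞ := fun m => (∫⁻ x, φ m x ^ (2 : ℝ) ∂μ) ^ (1 / 2 : ℝ) with hA
  set B : ℕ → ℝ≥0∞ := fun m => (∫⁻ x, ψ m x ^ (2 : ℝ) ∂μ) ^ (1 / 2 : ℝ) with hB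
  have two_half : ∀ t : ℝ≥0∞, (t ^ (1 / 2 : ℝ)) ^ (2 : ℝ) = t := fun t => by
    rw [← ENNReal.rpow_mul]; norm_num
  -- Step 1: Minkowski in `L²(μ)` for each order `m`.
  have step : ∀ m ∈ S, ∫⁻ x, χ m x ^ (2 : ℝ) ∂μ ≤ (A m + B m) ^ (2 : ℝ) := by
    intro m hm
    calc ∫⁻ x, χ m x ^ (2 : ℝ) ∂μ
        ≤ ∫⁻ x, (φ m + ψ m) x ^ (2 : ℝ) ∂μ :=
          lintegral_mono_ae ((hle m hm).mono fun x hx => ENNReal.rpow_le_rpow hx (by norm_num))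
      _ = ((∫⁻ x, (φ m + ψ m) x ^ (2 : ℝ) ∂μ) ^ (1 / 2 : ℝ)) ^ (2 : ℝ) := (two_half _).symm
      _ ≤ (A m + B m) ^ (2 : ℝ) :=
          ENNReal.rpow_le_rpow (ENNReal.lintegral_Lp_add_le (hφ m hm) (hψ m hm) (by norm_num))
            (by norm_num)
  -- Step 2: Minkowski in `ℓ²` over the orders `m ∈ S`.
  calc (∑ m ∈ S, ∫⁻ x, χ m x ^ (2 : ℝ) ∂μ) ^ (1 / 2 : ℝ)
      ≤ (∑ m ∈ S, (A m + B m) ^ (2 : ℝ)) ^ (1 / 2 : ℝ) :=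
        ENNReal.rpow_le_rpow (Finset.sum_le_sum step) (by norm_num)
    _ ≤ (∑ m ∈ S, A m ^ (2 : ℝ)) ^ (1 / 2 : ℝ) + (∑ m ∈ S, B m ^ (2 : ℝ)) ^ (1 / 2 : ℝ) :=
        ENNReal.Lp_add_le S A B (by norm_num)
    _ = (∑ m ∈ S, ∫⁻ x, φ m x ^ (2 : ℝ) ∂μ) ^ (1 / 2 : ℝ) +
          (∑ m ∈ S, ∫⁻ x, ψ m x ^ (2 : ℝ) ∂μ) ^ (1 / 2 : ℝ) := by
        simp only [hA, hB, two_half]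

variable {F G : Type*} [NormedAddCommGroup F] [NormedSpace ℝ F] [NormedAddCommGroup G]
  [NormedSpace ℝ G]

/-- Pointwise triangle inequality for the order-`m` weighted size function
`φ_m(u)(x) = (1+‖x‖)^{δ+m} ‖D^m u(x)‖ ∈ [0, ∞]` on an open set `U`, for `f`, `g` smooth on `U`:
`φ_m(f+g)(x) ≤ φ_m(f)(x) + φ_m(g)(x)` for `x ∈ U` (additivity of `iteratedFDeriv` at interior
points, `iteratedFDeriv_add_apply`). Bartnik 1986, §1, (1.1)–(1.2). [cite: Bartnik1986, §1, Def. 1.1 and (1.1)–(1.2), p. 663] -/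
private theorem ofReal_weight_mul_norm_iteratedFDeriv_add_le {U : Set F} (hU : IsOpen U) (δ : ℝ)
    (m : ℕ) {f g : F → G} (hf : ContDiffOn ℝ ∞ f U) (hg : ContDiffOn ℝ ∞ g U) {x : F}
    (hx : x ∈ U) :
    ENNReal.ofReal ((1 + ‖x‖) ^ (δ + m : ℝ) * ‖iteratedFDeriv ℝ m (f + g) x‖) ≤
      ENNReal.ofReal ((1 + ‖x‖) ^ (δ + m : ℝ) * ‖iteratedFDeriv ℝ m f x‖) +
        ENNReal.ofReal ((1 + ‖x‖) ^ (δ + m : ℝ) * ‖iteratedFDeriv ℝ m g x‖) := by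
  rw [← ENNReal.ofReal_add (by positivity) (by positivity), ← mul_add]
  refine ENNReal.ofReal_le_ofReal (mul_le_mul_of_nonneg_left ?_ (by positivity))
  have hf' : ContDiffAt ℝ (m : ℕ∞) f x :=
    (hf.of_le (by exact_mod_cast le_top)).contDiffAt (hU.mem_nhds hx)
  have hg' : ContDiffAt ℝ (m : ℕ∞) g x :=
    (hg.of_le (by exact_mod_cast le_top)).contDiffAt (hU.mem_nhds hx)
  rw [iteratedFDeriv_add_apply hf' hg']
  exact norm_add_le _ _

variable [MeasureSpace F]

/-- The weighted Sobolev seminorm written through the order-`m` weighted size functions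
`φ_m(u)(x) = (1+‖x‖)^{δ+m} ‖D^m u(x)‖`: `‖u‖_{H^s_δ(U)} = (∑_{m ≤ s} ∫_U φ_m(u)²)^{1/2}`
(`(1+‖x‖)^{2(δ+m)} ‖D^m u‖² = φ_m(u)²`). Bartnik 1986, §1, (1.1)–(1.2). [cite: Bartnik1986, §1, Def. 1.1 and (1.1)–(1.2), p. 663] -/
private theorem weightedSobolevSeminorm_eq_rpow_sum_lintegral (U : Set F) (s : ℕ) (δ : ℝ)
    (u : F → G) :
    weightedSobolevSeminorm U s δ u =
      (∑ m ∈ Finset.range (s + 1), ∫⁻ x in U,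
        ENNReal.ofReal ((1 + ‖x‖) ^ (δ + m : ℝ) * ‖iteratedFDeriv ℝ m u x‖) ^ (2 : ℝ)) ^
          (1 / 2 : ℝ) := by
  unfold weightedSobolevSeminorm
  congr 1
  refine Finset.sum_congr rfl fun m _ => ?_
  refine lintegral_congr fun x => ?_
  have hx : (0 : ℝ) ≤ 1 + ‖x‖ := by positivity
  rw [ENNReal.rpow_two, ← ENNReal.ofReal_pow (by positivity), mul_pow, mul_comm (2 : ℝ) _,
    Real.rpow_mul hx, Real.rpow_two]

/-- The order-`m` weighted size function `x ↦ (1+‖x‖)^{δ+m} ‖D^m u(x)‖ ∈ [0, ∞]` is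
a.e.-measurable on the open set `U` (Borel measure) when `u` is `C^∞` on `U`: it is continuous
on `U`. Bartnik 1986, §1, (1.1)–(1.2). [cite: Bartnik1986, §1, Def. 1.1 and (1.1)–(1.2), p. 663] -/
private theorem aemeasurable_ofReal_weight_mul_norm_iteratedFDeriv [BorelSpace F] {U : Set F}
    (hU : IsOpen U) (δ : ℝ) (m : ℕ) {u : F → G} (hu : ContDiffOn ℝ ∞ u U) :
    AEMeasurable (fun x => ENNReal.ofReal ((1 + ‖x‖) ^ (δ + m : ℝ) * ‖iteratedFDeriv ℝ m u x‖))
      (volume.restrict U) := by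
  have hcont : ContinuousOn (iteratedFDeriv ℝ m u) U :=
    (hu.continuousOn_iteratedFDerivWithin (by exact_mod_cast le_top) hU.uniqueDiffOn).congr
      fun x hx => (iteratedFDerivWithin_of_isOpen m hU hx).symm
  have hw : Continuous fun x : F => (1 + ‖x‖) ^ (δ + m : ℝ) :=
    (continuous_const.add continuous_norm).rpow_const fun x =>
      Or.inl (add_pos_of_pos_of_nonneg one_pos (norm_nonneg x)).ne'
  exact ENNReal.measurable_ofReal.comp_aemeasurable
    ((hw.continuousOn.mul hcont.norm).aemeasurable hU.measurableSet)

/-- **Discharge of `weightedSobolevSeminorm_add_le`** (Minkowski's inequality for the weighted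
Sobolev seminorm `H^s_δ(U)` on an open set `U`, for functions smooth on `U`):
`‖f + g‖_{H^s_δ(U)} ≤ ‖f‖_{H^s_δ(U)} + ‖g‖_{H^s_δ(U)}`. In print: Bartnik, CPAM 39 (1986), §1,
(1.1)–(1.2) — the weighted Sobolev norms make `W^{k,p}_δ` a normed (Banach) space, the triangle
inequality being Minkowski's inequality order by order; here (orders combined in `ℓ²`) it is
Minkowski in `L²(U)` for each order followed by Minkowski in `ℓ²` over the orders `m ≤ s`
(`rpow_sum_lintegral_rpow_le_add`), applied to the order-`m` size functions
`(1+‖x‖)^{δ+m} ‖D^m u(x)‖`, which are subadditive in `u` on `U` and a.e.-measurable on `U`. [cite: Bartnik1986, §1, Def. 1.1 and (1.1)–(1.2), p. 663] -/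
theorem weightedSobolevSeminorm_add_le_holds : weightedSobolevSeminorm_add_le (F := F) (G := G) := by
  intro _ U hU s δ f g hf hg
  rw [weightedSobolevSeminorm_eq_rpow_sum_lintegral, weightedSobolevSeminorm_eq_rpow_sum_lintegral,
    weightedSobolevSeminorm_eq_rpow_sum_lintegral]
  exact rpow_sum_lintegral_rpow_le_add (volume.restrict U) (Finset.range (s + 1))
    (φ := fun m x => ENNReal.ofReal ((1 + ‖x‖) ^ (δ + m : ℝ) * ‖iteratedFDeriv ℝ m f x‖))
    (ψ := fun m x => ENNReal.ofReal ((1 + ‖x‖) ^ (δ + m : ℝ) * ‖iteratedFDeriv ℝ m g x‖))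
    (χ := fun m x => ENNReal.ofReal ((1 + ‖x‖) ^ (δ + m : ℝ) * ‖iteratedFDeriv ℝ m (f + g) x‖))
    (fun m _ => aemeasurable_ofReal_weight_mul_norm_iteratedFDeriv hU δ m hf)
    (fun m _ => aemeasurable_ofReal_weight_mul_norm_iteratedFDeriv hU δ m hg)
    (fun m _ => (ae_restrict_iff' hU.measurableSet).2 (ae_of_all _ fun x hx =>
      ofReal_weight_mul_norm_iteratedFDeriv_add_le hU δ m hf hg hx))

end SobolevMinkowski

/-! ### Triangle inequality for the weighted Sobolev data distance -/

namespace InitialDataSet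

variable {U : Opens E3}

/-- **Discharge of the named fact `dataWeightedSobolevEDist_triangle`**: the weighted Sobolev
distance `‖h₁ - h₂‖_{H^s_δ(U)} + ‖k₁ - k₂‖_{H^{s-1}_{δ+1}(U)}` of initial data sets on an open
`U ⊆ E3` satisfies the triangle inequality (write `h₁ - h₃ = (h₁ - h₂) + (h₂ - h₃)`, likewise for
`k`; the differences are smooth on `U` by `contDiffOn_hFun_holds`, `contDiffOn_kFun_holds`, so
Minkowski's inequality `weightedSobolevSeminorm_add_le_holds` applies, Lebesgue measure on `E3`
being Borel). Bartnik 1986, §1, Def. 1.1 and (1.1)–(1.2) (the `W^{k,2}_δ` norms), Def. 2.1. [cite: Bartnik1986, §1, Def. 1.1 and (1.1)–(1.2), p. 663] -/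
theorem dataWeightedSobolevEDist_triangle_holds : dataWeightedSobolevEDist_triangle (U := U) := by
  intro s δ D₁ D₂ D₃
  have hU : IsOpen (U : Set E3) := U.isOpen
  have eh : D₁.hFun - D₃.hFun = (D₁.hFun - D₂.hFun) + (D₂.hFun - D₃.hFun) :=
    (sub_add_sub_cancel D₁.hFun D₂.hFun D₃.hFun).symm
  have ek : D₁.kFun - D₃.kFun = (D₁.kFun - D₂.kFun) + (D₂.kFun - D₃.kFun) :=
    (sub_add_sub_cancel D₁.kFun D₂.kFun D₃.kFun).symm
  have h₁₂ : ContDiffOn ℝ ∞ (D₁.hFun - D₂.hFun) U :=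
    (contDiffOn_hFun_holds D₁).sub (contDiffOn_hFun_holds D₂)
  have h₂₃ : ContDiffOn ℝ ∞ (D₂.hFun - D₃.hFun) U :=
    (contDiffOn_hFun_holds D₂).sub (contDiffOn_hFun_holds D₃)
  have k₁₂ : ContDiffOn ℝ ∞ (D₁.kFun - D₂.kFun) U :=
    (contDiffOn_kFun_holds D₁).sub (contDiffOn_kFun_holds D₂)
  have k₂₃ : ContDiffOn ℝ ∞ (D₂.kFun - D₃.kFun) U :=
    (contDiffOn_kFun_holds D₂).sub (contDiffOn_kFun_holds D₃)
  unfold dataWeightedSobolevEDist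
  rw [eh, ek]
  calc weightedSobolevSeminorm (U : Set E3) s δ ((D₁.hFun - D₂.hFun) + (D₂.hFun - D₃.hFun)) +
        weightedSobolevSeminorm (U : Set E3) (s - 1) (δ + 1)
          ((D₁.kFun - D₂.kFun) + (D₂.kFun - D₃.kFun))
      ≤ (weightedSobolevSeminorm (U : Set E3) s δ (D₁.hFun - D₂.hFun) +
          weightedSobolevSeminorm (U : Set E3) s δ (D₂.hFun - D₃.hFun)) +
        (weightedSobolevSeminorm (U : Set E3) (s - 1) (δ + 1) (D₁.kFun - D₂.kFun) +
          weightedSobolevSeminorm (U : Set E3) (s - 1) (δ + 1) (D₂.kFun - D₃.kFun)) :=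
        add_le_add (weightedSobolevSeminorm_add_le_holds hU s δ h₁₂ h₂₃)
          (weightedSobolevSeminorm_add_le_holds hU (s - 1) (δ + 1) k₁₂ k₂₃)
    _ = _ := add_add_add_comm _ _ _ _

end InitialDataSet

end Literature.Geometry.Lorentzian

end
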